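import Literature.RepresentationTheory.HeisenbergGroup.HeisenbergPairTensorIrreducible
import Literature.RepresentationTheory.HeisenbergGroup.SchrodingerL2HaarIrreducible
import Literature.RepresentationTheory.HeisenbergGroup.SchrodingerL2HaarReal
import Literature.RepresentationTheory.HeisenbergGroup.SchrodingerL2HaarTwoFactors
import Literature.NumberTheory.Automorphic.AdeleAddCharArchimedeanLinearForm
import Literature.NumberTheory.Automorphic.AdeleAddCharProductFormula
import Literature.NumberTheory.Automorphic.FiniteAdeleDualLatticePair
import Literature.NumberTheory.Automorphic.AdelicPiSchwartzBruhatFourier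
import Literature.NumberTheory.Weil1964.AdelicHeisenbergSchrodinger
import Literature.RepresentationTheory.HeisenbergGroup.HeisenbergCoboundary
import HarnessLib

/-!
# The `L²` Schrödinger representation of the adelic Heisenberg group `H(W_𝐀)` on `L²(𝐀_Kⁿ)` is IRREDUCIBLE

Topic `NumberTheory/Weil1964`; namespace `Literature.NumberTheory.Weil1964`.  KERNEL ONLY: theorems; no definition, no
named fact, no record, no `sorry`.

[GelbartRogawski1991, §3.1 p. 454 L19–21] quantify over "an irreducible unitary representation `ρ_ψ` of `H_𝐀(W)` with
central character `ψ`" on a Hilbert space; the tree's smooth model of record is Weil's Schrödinger representation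
`adelicSchrodinger K ι T` on the Schwartz–Bruhat space `𝒮(𝐀_K^ι)` (`AdelicHeisenbergSchrodinger.lean`; [Weil1964,
Chap. I n° 4 p. 149, n° 11–13]; [MoeglinVignerasWaldspurger1987, Chap. 2 I.4 Exemple (1)]).  Its HILBERT-SPACE completion
is `SchrodingerHaar.rep (adelicForm K ι T) ψ … ν` on `L²(𝐀_K^ι, ν)` (`SchrodingerL2Haar.lean`, same pointwise formula
`ψ(t + ⟨u, T y⟩) Φ(u + x)`, `ν` a Haar measure; unitary, strongly continuous, central character `ψ`).  This file proves
the remaining defining property of the printed `ρ_ψ` for that model: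

**`adelicSchrodingerL2_irreducible`** — for a number field `K`, a finite index type `ι`, a global additive character
`ψ` of `𝐀_K/K` (`IsGlobalAddChar`: continuous, trivial on `K`, non-trivial), a Gram matrix `T` with `y ↦ T y` onto, and
ANY Haar measure `ν` on `𝐀_K^ι`, the only closed subspaces of `L²(𝐀_K^ι, ν)` invariant under all `ρ(h)`,
`h ∈ H(W_𝐀) = AdelicHeisenberg K ι T`, are `⊥` and `⊤`.

Proof (all inputs are tree theorems): reduce to `T = 1` (`rep_eq_rep_of_forall_apply`); write
`ν = c · split_*(μ_∞ ⊗ μ_f)` along `𝐀_K^ι ≅ (K ⊗ ℝ)^ι × (𝐀_K^∞)^ι` (`exists_haar_eq_smul_map_prod`) and discard `c`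
(`irreducible_smul_measure_iff`); along the unitary `F ↦ F ∘ split` the archimedean and finite-adelic Heisenberg
groups act on tensors by `ρ_∞ ⊗ 1` and `1 ⊗ ρ_f` (`compMeasurePreserving_rep_inl_tensor` / `_inr_tensor`), where
`ρ_∞` on `L²((K ⊗ ℝ)^ι)` is irreducible by von Neumann's theorem (`SchrodingerHaar.irreducible_real`; `ψ_∞ = 𝐞 ∘ ℓ`,
`AdeleAddCharArchimedeanLinearForm`) and `ρ_f` on `L²((𝐀_K^∞)^ι)` is irreducible by the lattice method
(`SchrodingerHaar.irreducible_of_isDualLatticePair`; the dual lattice pair `((∏𝒪_v)^ι, (∏𝔠_{ψ_v})^ι)` of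
`FiniteAdeleDualLatticePair`, `ψ_f = ∏ ψ_v` by `AdeleAddCharProductFormula`); the pair is then jointly irreducible
(`irreducible_tensor_of_irreducible_heisenberg_pair`) and irreducibility transfers back
(`irreducible_of_irreducible_of_semiconj`).  Nothing of the cited sources is asserted; `Prop311AsPrinted` is untouched.

## References
* [GelbartRogawski1991] S. Gelbart, J. Rogawski, Invent. Math. 105 (1991), §3.1 p. 454 L17–21.
* [Weil1964] A. Weil, Acta Math. 111 (1964), Chap. I n° 4 p. 149, n° 11–13, Chap. III n° 37–39.
* [MoeglinVignerasWaldspurger1987] C. Mœglin, M.-F. Vignéras, J.-L. Waldspurger, LNM 1291 (1987), Chap. 2 I.2–I.4.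
* [vonNeumann1931] J. von Neumann, Math. Ann. 104 (1931) 570–578.
-/

set_option autoImplicit false

noncomputable section

open MeasureTheory Filter Set NumberField IsDedekindDomain NumberField.InfinitePlace NumberField.mixedEmbedding
  InfiniteAdeleRing
open scoped ENNReal Topology FourierTransform Pointwise RestrictedProduct Matrix
open Literature.RepresentationTheory.HeisenbergGroup Literature.RepresentationTheory.HeisenbergGroup.RestrictedPair
  Literature.NumberTheory.Automorphic Literature.MeasureTheory.Integral

namespace Literature.NumberTheory.Weil1964

attribute [local instance] secondCountableTopology_adeleRing locallyCompactSpace_adeleRing'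
  secondCountableTopology_finiteAdeleRing locallyCompactSpace_finiteAdeleRing'

/-! ## §1 Small inputs -/

section Inputs

variable (K : Type) [Field K] [NumberField K] (ι : Type) [Fintype ι] [DecidableEq ι]

/-- `u ↦ ⟨u, T y⟩` is continuous on `𝐀_K^ι`. [cite: Weil1964, Chap. I n° 4 p. 149] -/
theorem continuous_adelicForm_left (T : Matrix ι ι (AdeleRing (𝓞 K) K)) (y : ι → AdeleRing (𝓞 K) K) :
    Continuous fun u : ι → AdeleRing (𝓞 K) K => adelicForm K ι T u y := by
  simp only [adelicForm_apply]
  exact continuous_id.dotProduct continuous_const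

/-- `L²(X, μ) ≠ 0` for a Haar measure on a locally compact group (indicator of a compact neighbourhood).
[cite: Weil1964, Chap. I n° 11] -/
theorem nontrivial_Lp_of_isAddHaarMeasure {X : Type*} [AddCommGroup X] [TopologicalSpace X] [LocallyCompactSpace X]
    [MeasurableSpace X] [BorelSpace X] (μ : Measure X) [μ.IsAddHaarMeasure] : Nontrivial (Lp ℂ 2 μ) := by
  obtain ⟨C, hC, hC0⟩ := exists_compact_mem_nhds (0 : X)
  have hpos : μ (interior C) ≠ 0 :=
    (isOpen_interior.measure_pos μ ⟨0, mem_interior_iff_mem_nhds.2 hC0⟩).ne'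
  have htop : μ (interior C) ≠ ⊤ := ((measure_mono interior_subset).trans_lt hC.measure_lt_top).ne
  refine ⟨⟨indicatorConstLp 2 isOpen_interior.measurableSet htop (1 : ℂ), 0, ?_⟩⟩
  rw [← norm_ne_zero_iff, norm_indicatorConstLp two_ne_zero ENNReal.ofNat_ne_top, norm_one, one_mul]
  exact (Real.rpow_pos_of_pos (ENNReal.toReal_pos hpos htop) _).ne'

/-- non-degeneracy of the commutator form of `polar β` for the dot pairing over a commutative ring:
`x = (a, b) ≠ 0 ⇒ ∃ y, a · y₂ - y₁ · b ≠ 0`. [cite: Weil1964, Chap. I n° 4 p. 149] -/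
theorem exists_polar_sub_polar_ne_zero {R : Type*} [CommRing R] {m : Type*} [Fintype m] [DecidableEq m]
    (x : (m → R) × (m → R)) (hx : x ≠ 0) :
    ∃ y : (m → R) × (m → R), polar (Matrix.toLinearMap₂' R (1 : Matrix m m R)) x y -
      polar (Matrix.toLinearMap₂' R (1 : Matrix m m R)) y x ≠ 0 := by
  simp only [polar_apply, Matrix.toLinearMap₂'_apply', Matrix.one_mulVec]
  by_cases ha : x.1 = 0
  · have hb : x.2 ≠ 0 := fun hb => hx (Prod.ext ha hb)
    obtain ⟨i, hi⟩ : ∃ i, x.2 i ≠ 0 := by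
      by_contra h
      push Not at h
      exact hb (funext h)
    refine ⟨(-Pi.single i 1, 0), ?_⟩
    rw [ha, zero_dotProduct, zero_sub, neg_dotProduct, single_one_dotProduct, neg_neg]
    exact hi
  · obtain ⟨i, hi⟩ : ∃ i, x.1 i ≠ 0 := by
      by_contra h
      push Not at h
      exact ha (funext h)
    refine ⟨(0, Pi.single i 1), ?_⟩
    rw [zero_dotProduct, sub_zero, dotProduct_single_one]
    exact hi

end Inputs

/-! ## §2 The theorem -/

section Main

variable (K : Type) [Field K] [NumberField K] (ι : Type) [Fintype ι] [DecidableEq ι]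
  [MeasurableSpace (AdeleRing (𝓞 K) K)] [BorelSpace (AdeleRing (𝓞 K) K)]

set_option maxHeartbeats 400000 in -- the assembly elaborates ~40 large hypotheses (restricted products, Haar measures)
/-- **The `L²` Schrödinger representation of `H(W_𝐀)` on `L²(𝐀_K^ι)` for the STANDARD pairing is irreducible.**
`ψ` a global additive character of `𝐀_K/K`, `ν` any Haar measure on `𝐀_K^ι`: a closed subspace of `L²(𝐀_K^ι, ν)`
invariant under all `ρ(h) = SchrodingerHaar.rep (adelicForm K ι 1) ψ … ν h` is `⊥` or `⊤`.
[cite: GelbartRogawski1991, §3.1 p. 454 L19–21] [cite: MoeglinVignerasWaldspurger1987, Chap. 2 I.2 Théorème] -/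
theorem adelicSchrodingerL2_irreducible_one (ψ : AddChar (AdeleRing (𝓞 K) K) Circle) (hψ : IsGlobalAddChar K ψ)
    (ν : Measure (ι → AdeleRing (𝓞 K) K)) [ν.IsAddHaarMeasure]
    (L : Submodule ℂ (Lp ℂ 2 ν)) (hLc : IsClosed (L : Set (Lp ℂ 2 ν)))
    (hL : ∀ (h : AdelicHeisenberg K ι 1), ∀ f ∈ L,
      SchrodingerHaar.rep (adelicForm K ι 1) ψ hψ.continuous (continuous_adelicForm_left K ι 1) ν h f ∈ L) :
    L = ⊥ ∨ L = ⊤ := by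
  classical
  haveI : Fact (∀ v : HeightOneSpectrum (𝓞 K), IsOpen (v.adicCompletionIntegers K : Set (v.adicCompletion K))) :=
    ⟨fun _ => Valued.isOpen_valuationSubring _⟩
  letI mf : MeasurableSpace (FiniteAdeleRing (𝓞 K) K) := borel _
  haveI : BorelSpace (FiniteAdeleRing (𝓞 K) K) := ⟨rfl⟩
  haveI : BorelSpace (ι → AdeleRing (𝓞 K) K) := Pi.borelSpace
  haveI : BorelSpace (ι → FiniteAdeleRing (𝓞 K) K) := Pi.borelSpace
  haveI : BorelSpace (ι → mixedSpace K) := Pi.borelSpace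
  haveI : BorelSpace ((ι → mixedSpace K) × (ι → FiniteAdeleRing (𝓞 K) K)) := Prod.borelSpace
  have hψc : Continuous ψ := hψ.continuous
  set β : (ι → AdeleRing (𝓞 K) K) →ₗ[AdeleRing (𝓞 K) K] (ι → AdeleRing (𝓞 K) K) →ₗ[AdeleRing (𝓞 K) K] AdeleRing (𝓞 K) K := adelicForm K ι 1 with hβ
  have hβc : ∀ y, Continuous fun u : ι → AdeleRing (𝓞 K) K => β u y := continuous_adelicForm_left K ι 1
  have hβ₁ : ∀ x y : ι → AdeleRing (𝓞 K) K, β x y = x ⬝ᵥ y := fun x y => adelicForm_one_apply x y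
  /- the archimedean data: `mixedSpace K = K ⊗ ℝ`, `βM` the dot pairing, `ψM = ψ ∘ (·, 0)`, `ℓ` -/
  set βM : (ι → mixedSpace K) →ₗ[mixedSpace K] (ι → mixedSpace K) →ₗ[mixedSpace K] mixedSpace K := Matrix.toLinearMap₂' (mixedSpace K) (1 : Matrix ι ι (mixedSpace K)) with hβM
  have hβM₁ : ∀ x y : ι → mixedSpace K, βM x y = x ⬝ᵥ y := fun x y => by
    rw [hβM, Matrix.toLinearMap₂'_apply', Matrix.one_mulVec]
  let r₁ : mixedSpace K →ₙ+* AdeleRing (𝓞 K) K := (infiniteAdeleInl K).comp (ringEquiv_mixedSpace K).symm.toNonUnitalRingHom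
  have hr₁ : ∀ t : mixedSpace K, r₁ t = ((ringEquiv_mixedSpace K).symm t, 0) := fun t => rfl
  let ψM : AddChar (mixedSpace K) Circle := ψ.compAddMonoidHom r₁.toAddMonoidHom
  have hψM : ∀ t, ψM t = ψ (r₁ t) := fun t => rfl
  have hψMc : Continuous ψM :=
    hψc.comp ((continuous_infiniteAdeleInl K).comp (continuous_ringEquiv_mixedSpace_symm (K := K)))
  have hβMc : ∀ y, Continuous fun u : ι → mixedSpace K => βM u y := fun y => by
    simp only [hβM₁]; exact continuous_id.dotProduct continuous_const
  have hβMc' : ∀ u, Continuous fun y : ι → mixedSpace K => βM u y := fun u => by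
    simp only [hβM₁]; exact continuous_const.dotProduct continuous_id
  obtain ⟨ℓ, hℓψ, hℓnd, hℓsurj⟩ := hψ.exists_linearMap_fourierChar_eq
  have hψMℓ : ∀ t : mixedSpace K, ψM t = 𝐞 (ℓ t) := fun t => by
    rw [hψM, hr₁, ← infiniteAdeleInl_apply, hℓψ, RingEquiv.apply_symm_apply]
  /- the finite-adelic data: `βf` the dot pairing, `ψf = ∏ ψ_v`, the dual lattice pair -/
  set βf : (ι → FiniteAdeleRing (𝓞 K) K) →ₗ[FiniteAdeleRing (𝓞 K) K] (ι → FiniteAdeleRing (𝓞 K) K) →ₗ[FiniteAdeleRing (𝓞 K) K] FiniteAdeleRing (𝓞 K) K := Matrix.toLinearMap₂' (FiniteAdeleRing (𝓞 K) K) (1 : Matrix ι ι (FiniteAdeleRing (𝓞 K) K)) with hβf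
  have hβf₁ : ∀ x y : ι → FiniteAdeleRing (𝓞 K) K, βf x y = x ⬝ᵥ y := fun x y => by
    rw [hβf, Matrix.toLinearMap₂'_apply', Matrix.one_mulVec]
  let r₂ : FiniteAdeleRing (𝓞 K) K →ₙ+* AdeleRing (𝓞 K) K := finiteAdeleInr K
  have hr₂ : ∀ t : FiniteAdeleRing (𝓞 K) K, r₂ t = (0, t) := fun t => rfl
  let ψf : AddChar (FiniteAdeleRing (𝓞 K) K) Circle :=
    prodChar (A := fun v : HeightOneSpectrum (𝓞 K) => v.adicCompletionIntegers K) (fun v => ψ.adicComponent v)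
      (eventually_forall_adicComponent_apply_eq_one hψc)
  have hψf_def : ∀ t : FiniteAdeleRing (𝓞 K) K, ψf t =
      prodChar (A := fun v : HeightOneSpectrum (𝓞 K) => v.adicCompletionIntegers K) (fun v => ψ.adicComponent v)
        (eventually_forall_adicComponent_apply_eq_one hψc) t := fun t => rfl
  have hψf : ∀ t : FiniteAdeleRing (𝓞 K) K, ψ (r₂ t) = ψf t := fun t => by
    rw [hr₂, map_zero_prod_eq_finprod_adicComponent hψc, hψf_def, prodChar_apply]
    rfl
  have hψfc : Continuous ψf := by
    have e : (ψf : FiniteAdeleRing (𝓞 K) K → Circle) = fun t => ψ (r₂ t) := funext fun t => (hψf t).symm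
    rw [e]
    exact hψc.comp (continuous_finiteAdeleInr K)
  have hβfc : ∀ y, Continuous fun u : ι → FiniteAdeleRing (𝓞 K) K => βf u y := fun y => by
    simp only [hβf₁]; exact continuous_id.dotProduct continuous_const
  have hβfc' : ∀ u, Continuous fun y : ι → FiniteAdeleRing (𝓞 K) K => βf u y := fun u => by
    simp only [hβf₁]; exact continuous_const.dotProduct continuous_id
  let L₁ : AddSubgroup (ι → FiniteAdeleRing (𝓞 K) K) :=
    AddSubgroup.pi Set.univ fun _ : ι =>
      (box (A := fun v : HeightOneSpectrum (𝓞 K) => v.adicCompletionIntegers K) fun v =>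
        (IsUltrametricDist.closedBall_openAddSubgroup (v.adicCompletion K) one_pos).toAddSubgroup)
  let L₂ : AddSubgroup (ι → FiniteAdeleRing (𝓞 K) K) :=
    AddSubgroup.pi Set.univ fun _ : ι =>
      (box (A := fun v : HeightOneSpectrum (𝓞 K) => v.adicCompletionIntegers K) fun v =>
        mulDual (ψ.adicComponent v))
  have hpair : IsDualLatticePair βf ψf L₁ L₂ := isDualLatticePair_finiteAdele_integers_conductor_pi hψ
  have hX : ∀ N ∈ 𝓝 (0 : ι → FiniteAdeleRing (𝓞 K) K), ∃ a : (FiniteAdeleRing (𝓞 K) K)ˣ, (((a : FiniteAdeleRing (𝓞 K) K) • L₁ : AddSubgroup (ι → FiniteAdeleRing (𝓞 K) K)) : Set (ι → FiniteAdeleRing (𝓞 K) K)) ⊆ N :=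
    fun N hN => exists_units_smul_finiteAdele_integers_pi_subset N hN
  have hY : ∀ N ∈ 𝓝 (0 : ι → FiniteAdeleRing (𝓞 K) K), ∃ a : (FiniteAdeleRing (𝓞 K) K)ˣ, (((a : FiniteAdeleRing (𝓞 K) K) • L₂ : AddSubgroup (ι → FiniteAdeleRing (𝓞 K) K)) : Set (ι → FiniteAdeleRing (𝓞 K) K)) ⊆ N :=
    fun N hN => exists_units_smul_finiteAdele_conductor_pi_subset hψ N hN
  /- the measures: `ν = c • split_*(μM ⊗ μf)` -/
  set μM : Measure (ι → mixedSpace K) := Measure.addHaarMeasure (Classical.arbitrary _) with hμM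
  haveI : μM.IsAddHaarMeasure := by rw [hμM]; infer_instance
  set μf : Measure (ι → FiniteAdeleRing (𝓞 K) K) := Measure.addHaarMeasure (Classical.arbitrary _) with hμf
  haveI : μf.IsAddHaarMeasure := by rw [hμf]; infer_instance
  obtain ⟨c, hc, hν⟩ := exists_haar_eq_smul_map_prod K ι ν μM μf
  set S := piAdeleSplit K ι with hS
  set ν₀ : Measure (ι → AdeleRing (𝓞 K) K) := (μM.prod μf).map S with hν₀
  haveI : (μM.prod μf).IsAddHaarMeasure := Measure.prod.instIsAddHaarMeasure μM μf
  haveI : ν₀.IsAddHaarMeasure := by rw [hν₀]; exact S.isAddHaarMeasure_map (μM.prod μf)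
  have hSm : MeasurePreserving S (μM.prod μf) ν₀ := ⟨S.continuous.measurable, rfl⟩
  have hSm' : MeasurePreserving S.symm ν₀ (μM.prod μf) := by
    have h := hSm.symm S.toHomeomorph.toMeasurableEquiv
    exact h
  have hν' : ν = (c : ℝ≥0∞) • ν₀ := by rw [hν, Measure.coe_nnreal_smul]
  -- discard the scalar
  subst hν'
  refine (SchrodingerHaar.irreducible_smul_measure_iff ν₀ β ψ hψc hβc (ENNReal.coe_ne_zero.2 hc.ne')
    ENNReal.coe_ne_top).1 ?_ L hLc hL
  intro L hLc hL
  /- the unitary `U : L²(ν₀) ≃ L²(μM ⊗ μf)`, `F ↦ F ∘ S` -/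
  obtain ⟨U, hU, hU'⟩ := SchrodingerHaar.exists_linearIsometryEquiv_compMeasurePreserving (S := (S : _ → ι → AdeleRing (𝓞 K) K))
    (S' := (S.symm : (ι → AdeleRing (𝓞 K) K) → _)) hSm hSm' (fun a => S.symm_apply_apply a) (fun b => S.apply_symm_apply b)
  /- the factor representations -/
  set π₁ := SchrodingerHaar.rep βM ψM hψMc hβMc μM with hπ₁
  set τ₂ := SchrodingerHaar.rep βf ψf hψfc hβfc μf with hτ₂
  -- the embeddings of the factors into `H(W_𝐀)` (as functions on elements)
  have hS₁ : ∀ (a : ι → mixedSpace K) (i : ι), S (a, 0) i = r₁ (a i) := fun a i => rfl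
  have hS₂ : ∀ (b : ι → FiniteAdeleRing (𝓞 K) K) (i : ι), S (0, b) i = r₂ (b i) := fun b i => by
    rw [hr₂]
    exact Prod.ext (map_zero (ringEquiv_mixedSpace K).symm) rfl
  have h₁ : ∀ (x₁ : ι → mixedSpace K) (y₁ : ι → mixedSpace K), β (S.toAddMonoidHom (x₁, 0)) (S (y₁, 0)) = r₁.toAddMonoidHom (βM x₁ y₁) := by
    intro x₁ y₁
    change β (S (x₁, 0)) (S (y₁, 0)) = r₁ (βM x₁ y₁)
    rw [hβ₁, hβM₁, dotProduct, dotProduct, map_sum]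
    refine Finset.sum_congr rfl fun i _ => ?_
    rw [hS₁, hS₁, map_mul]
  have h₂ : ∀ (x₂ : ι → FiniteAdeleRing (𝓞 K) K) (y₂ : ι → FiniteAdeleRing (𝓞 K) K), β (S.toAddMonoidHom (0, x₂)) (S (0, y₂)) = r₂.toAddMonoidHom (βf x₂ y₂) := by
    intro x₂ y₂
    change β (S (0, x₂)) (S (0, y₂)) = r₂ (βf x₂ y₂)
    rw [hβ₁, hβf₁, dotProduct, dotProduct, map_sum]
    refine Finset.sum_congr rfl fun i _ => ?_
    rw [hS₂, hS₂, map_mul]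
  have h₂₁ : ∀ (x₂ : ι → FiniteAdeleRing (𝓞 K) K) (y₁ : ι → mixedSpace K), β (S.toAddMonoidHom (0, x₂)) (S (y₁, 0)) = 0 := by
    intro x₂ y₁
    change β (S (0, x₂)) (S (y₁, 0)) = 0
    rw [hβ₁, dotProduct]
    refine Finset.sum_eq_zero fun i _ => ?_
    rw [hS₂, hS₁, hr₁, hr₂]
    exact Prod.ext (zero_mul _) (mul_zero _)
  have h₁₂ : ∀ (x₁ : ι → mixedSpace K) (y₂ : ι → FiniteAdeleRing (𝓞 K) K), β (S.toAddMonoidHom (x₁, 0)) (S (0, y₂)) = 0 := by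
    intro x₁ y₂
    change β (S (x₁, 0)) (S (0, y₂)) = 0
    rw [hβ₁, dotProduct]
    refine Finset.sum_eq_zero fun i _ => ?_
    rw [hS₂, hS₁, hr₁, hr₂]
    exact Prod.ext (mul_zero _) (zero_mul _)
  have hrψ₁ : ∀ t : mixedSpace K, ψ (r₁.toAddMonoidHom t) = ψM t := fun t => rfl
  have hrψ₂ : ∀ t : FiniteAdeleRing (𝓞 K) K, ψ (r₂.toAddMonoidHom t) = ψf t := fun t => hψf t
  -- the group homomorphisms `ι₁ : H(W_∞) → H(W_𝐀)`, `ι₂ : H(W_fin) → H(W_𝐀)`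
  let j₁ : (ι → mixedSpace K) × (ι → mixedSpace K) →+ (ι → AdeleRing (𝓞 K) K) × (ι → AdeleRing (𝓞 K) K) :=
    (S.toAddMonoidHom.comp (AddMonoidHom.inl (ι → mixedSpace K) (ι → FiniteAdeleRing (𝓞 K) K))).prodMap
      (S.toAddMonoidHom.comp (AddMonoidHom.inl (ι → mixedSpace K) (ι → FiniteAdeleRing (𝓞 K) K)))
  have hjk₁ : ∀ v w, polar β (j₁ v) (j₁ w) = r₁.toAddMonoidHom (polar βM v w) := fun v w => h₁ v.1 w.2
  let ι₁ : Heisenberg (polar βM) →* Heisenberg (polar β) := Heisenberg.map (polar β) j₁ r₁.toAddMonoidHom hjk₁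
  have hι₁ : ∀ (x₁ y₁ : ι → mixedSpace K) (t₁ : mixedSpace K), ι₁ ⟨(x₁, y₁), t₁⟩ = ⟨(S.toAddMonoidHom (x₁, 0), S (y₁, 0)), r₁.toAddMonoidHom t₁⟩ :=
    fun x₁ y₁ t₁ => rfl
  let j₂ : (ι → FiniteAdeleRing (𝓞 K) K) × (ι → FiniteAdeleRing (𝓞 K) K) →+ (ι → AdeleRing (𝓞 K) K) × (ι → AdeleRing (𝓞 K) K) :=
    (S.toAddMonoidHom.comp (AddMonoidHom.inr (ι → mixedSpace K) (ι → FiniteAdeleRing (𝓞 K) K))).prodMap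
      (S.toAddMonoidHom.comp (AddMonoidHom.inr (ι → mixedSpace K) (ι → FiniteAdeleRing (𝓞 K) K)))
  have hjk₂ : ∀ v w, polar β (j₂ v) (j₂ w) = r₂.toAddMonoidHom (polar βf v w) := fun v w => h₂ v.1 w.2
  let ι₂ : Heisenberg (polar βf) →* Heisenberg (polar β) := Heisenberg.map (polar β) j₂ r₂.toAddMonoidHom hjk₂
  have hι₂ : ∀ (x₂ y₂ : ι → FiniteAdeleRing (𝓞 K) K) (t₂ : FiniteAdeleRing (𝓞 K) K), ι₂ ⟨(x₂, y₂), t₂⟩ = ⟨(S.toAddMonoidHom (0, x₂), S (0, y₂)), r₂.toAddMonoidHom t₂⟩ :=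
    fun x₂ y₂ t₂ => rfl
  /- the conjugated representations `π = U (ρ ∘ ι₁) U⁻¹`, `τ = U (ρ ∘ ι₂) U⁻¹` on `L²(μM ⊗ μf)` -/
  set ρ := SchrodingerHaar.rep β ψ hψc hβc ν₀ with hρ
  obtain ⟨π, hπ⟩ := SchrodingerHaar.exists_rep_conj (ρ.comp ι₁) U
  obtain ⟨τ, hτ⟩ := SchrodingerHaar.exists_rep_conj (ρ.comp ι₂) U
  have hρu : ∀ h F, ‖ρ h F‖ = ‖F‖ := fun h F => SchrodingerHaar.norm_rep_apply β ψ hψc hβc ν₀ h F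
  have hπu : ∀ h F, ‖π h F‖ = ‖F‖ := fun h F => by
    rw [hπ, LinearIsometryEquiv.norm_map, MonoidHom.coe_comp, Function.comp_apply, hρu,
      LinearIsometryEquiv.norm_map]
  have hτu : ∀ h F, ‖τ h F‖ = ‖F‖ := fun h F => by
    rw [hτ, LinearIsometryEquiv.norm_map, MonoidHom.coe_comp, Function.comp_apply, hρu,
      LinearIsometryEquiv.norm_map]
  have hSm'' : MeasurePreserving (S.toAddMonoidHom : _ → ι → AdeleRing (𝓞 K) K) (μM.prod μf) ν₀ := hSm
  have hπt : ∀ (h : Heisenberg (polar βM)) (f : Lp ℂ 2 μM) (g : Lp ℂ 2 μf),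
      π h ((memLp_tensor_Lp μM μf f g).toLp _) = (memLp_tensor_Lp μM μf (π₁ h f) g).toLp _ := by
    rintro ⟨⟨x₁, y₁⟩, t₁⟩ f g
    rw [hπ, hU, hU', MonoidHom.coe_comp, Function.comp_apply, hι₁, hπ₁]
    exact SchrodingerHaar.compMeasurePreserving_rep_inl_tensor β βM ψ ψM hψc hψMc hβc hβMc ν₀ μM μf hSm'' hSm'
      (fun z => S.symm_apply_apply z) h₁ h₂₁ hrψ₁ x₁ y₁ t₁ f g
  have hτt : ∀ (h : Heisenberg (polar βf)) (f : Lp ℂ 2 μM) (g : Lp ℂ 2 μf),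
      τ h ((memLp_tensor_Lp μM μf f g).toLp _) = (memLp_tensor_Lp μM μf f (τ₂ h g)).toLp _ := by
    rintro ⟨⟨x₂, y₂⟩, t₂⟩ f g
    rw [hτ, hU, hU', MonoidHom.coe_comp, Function.comp_apply, hι₂, hτ₂]
    exact SchrodingerHaar.compMeasurePreserving_rep_inr_tensor β βf ψ ψf hψc hψfc hβc hβfc ν₀ μM μf hSm'' hSm'
      (fun z => S.symm_apply_apply z) h₂ h₁₂ hrψ₂ x₂ y₂ t₂ f g
  /- the hypotheses on the factors -/
  haveI : Nontrivial (Lp ℂ 2 μM) := nontrivial_Lp_of_isAddHaarMeasure μM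
  haveI : Nontrivial (Lp ℂ 2 μf) := nontrivial_Lp_of_isAddHaarMeasure μf
  have h₁u : ∀ h f, ‖π₁ h f‖ = ‖f‖ := fun h f => SchrodingerHaar.norm_rep_apply βM ψM hψMc hβMc μM h f
  have h₁c : ∀ f : Lp ℂ 2 μM, Continuous fun y : (ι → mixedSpace K) × (ι → mixedSpace K) => π₁ ⟨y, 0⟩ f := fun f =>
    SchrodingerHaar.continuous_rep_mk_zero βM ψM hψMc hβMc μM hβMc' f
  have h₁z : ∀ (t : mixedSpace K) (f : Lp ℂ 2 μM),
      π₁ (Heisenberg.ofCenter (polar βM) (Multiplicative.ofAdd t)) f = ((𝐞 (ℓ t) : Circle) : ℂ) • f := fun t f => by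
    rw [hπ₁, SchrodingerHaar.rep_ofCenter, hψMℓ]
  have hYM : ∀ l : (ι → mixedSpace K) →ₗ[ℝ] ℝ, ∃ y : ι → mixedSpace K, ∀ u : ι → mixedSpace K, ψM (βM u y) = 𝐞 (l u) := by
    intro l
    -- `Φ : y ↦ (u ↦ ℓ (u · y))` is injective hence onto
    let Φ : (ι → mixedSpace K) →ₗ[ℝ] ((ι → mixedSpace K) →ₗ[ℝ] ℝ) :=
      LinearMap.mk₂ ℝ (fun y u => ℓ (u ⬝ᵥ y))
        (fun y y' u => by rw [dotProduct_add, map_add])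
        (fun a y u => by rw [dotProduct_smul, map_smul])
        (fun y u u' => by rw [add_dotProduct, map_add])
        (fun a y u => by rw [smul_dotProduct, map_smul])
    have hΦ : ∀ y u, Φ y u = ℓ (u ⬝ᵥ y) := fun y u => rfl
    have hinj : Function.Injective Φ := by
      refine (injective_iff_map_eq_zero Φ).2 fun y hy => ?_
      by_contra hy0
      obtain ⟨i, hi⟩ : ∃ i, y i ≠ 0 := by
        by_contra h
        push Not at h
        exact hy0 (funext h)
      obtain ⟨a, ha⟩ := hℓnd (y i) hi
      have h := LinearMap.congr_fun hy (Pi.single i a)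
      rw [hΦ, single_dotProduct, LinearMap.zero_apply] at h
      exact ha h
    have hsurj : Function.Surjective Φ :=
      (LinearMap.injective_iff_surjective_of_finrank_eq_finrank (Subspace.dual_finrank_eq).symm).1 hinj
    obtain ⟨y, hy⟩ := hsurj l
    refine ⟨y, fun u => ?_⟩
    rw [hψMℓ, hβM₁, ← hΦ, hy]
  have h₁i := SchrodingerHaar.irreducible_real βM ψM hψMc hβMc μM hYM
  have h₂u : ∀ h g, ‖τ₂ h g‖ = ‖g‖ := fun h g => SchrodingerHaar.norm_rep_apply βf ψf hψfc hβfc μf h g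
  have h₂c : ∀ g : Lp ℂ 2 μf, Continuous fun w : (ι → FiniteAdeleRing (𝓞 K) K) × (ι → FiniteAdeleRing (𝓞 K) K) => τ₂ ⟨w, 0⟩ g := fun g =>
    SchrodingerHaar.continuous_rep_mk_zero βf ψf hψfc hβfc μf hβfc' g
  have h₂z : ∀ (t : FiniteAdeleRing (𝓞 K) K) (g : Lp ℂ 2 μf),
      τ₂ (Heisenberg.ofCenter (polar βf) (Multiplicative.ofAdd t)) g = ((ψf t : Circle) : ℂ) • g := fun t g => by
    rw [hτ₂, SchrodingerHaar.rep_ofCenter]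
  have h₂i := SchrodingerHaar.irreducible_of_isDualLatticePair βf ψf hψfc hβfc μf hβfc' hpair hX
  have hs : (realForm (polar βM) ℓ - (realForm (polar βM) ℓ).flip).Nondegenerate :=
    nondegenerate_realForm_sub_flip (polar βM) ℓ hℓnd fun x hx => exists_polar_sub_polar_ne_zero x hx
  /- joint irreducibility on `L²(μM ⊗ μf)`, transported back along `U⁻¹` -/
  have key : ∀ K' : Submodule ℂ (Lp ℂ 2 (μM.prod μf)), IsClosed (K' : Set (Lp ℂ 2 (μM.prod μf))) →
      (∀ (g : Heisenberg (polar βM) ⊕ Heisenberg (polar βf)), ∀ F ∈ K',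
        (Sum.elim (fun h₁ => (π h₁ : Lp ℂ 2 (μM.prod μf) →ₗ[ℂ] Lp ℂ 2 (μM.prod μf)))
          (fun h₂ => (τ h₂ : Lp ℂ 2 (μM.prod μf) →ₗ[ℂ] Lp ℂ 2 (μM.prod μf))) g) F ∈ K') → K' = ⊥ ∨ K' = ⊤ := by
    intro K' hK'c hK'
    exact irreducible_tensor_of_irreducible_heisenberg_pair μM μf (polar βM) ℓ βf ψf hℓsurj hs hpair hX hY π₁ h₁u
      h₁c h₁z h₁i τ₂ h₂u h₂c h₂z h₂i π hπt hπu τ hτt hτu K' hK'c (fun h₁ F hF => hK' (Sum.inl h₁) F hF)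
      (fun h₂ F hF => hK' (Sum.inr h₂) F hF)
  refine SchrodingerHaar.irreducible_of_irreducible_of_semiconj
    (fun g : Heisenberg (polar βM) ⊕ Heisenberg (polar βf) =>
      Sum.elim (fun h₁ => (π h₁ : Lp ℂ 2 (μM.prod μf) →ₗ[ℂ] Lp ℂ 2 (μM.prod μf)))
        (fun h₂ => (τ h₂ : Lp ℂ 2 (μM.prod μf) →ₗ[ℂ] Lp ℂ 2 (μM.prod μf))) g)
    (fun h => ρ h) U.symm.toContinuousLinearEquiv (fun g => ?_) key L hLc hL
  rcases g with h₁ | h₂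
  · refine ⟨ι₁ h₁, fun v => ?_⟩
    change U.symm (π h₁ v) = ρ (ι₁ h₁) (U.symm v)
    rw [hπ, LinearIsometryEquiv.symm_apply_apply, MonoidHom.coe_comp, Function.comp_apply]
  · refine ⟨ι₂ h₂, fun v => ?_⟩
    change U.symm (τ h₂ v) = ρ (ι₂ h₂) (U.symm v)
    rw [hτ, LinearIsometryEquiv.symm_apply_apply, MonoidHom.coe_comp, Function.comp_apply]

/-- **The `L²` Schrödinger representation `ρ_ψ` of the adelic Heisenberg group `H(W_𝐀) = AdelicHeisenberg K ι T` on
`L²(𝐀_K^ι, ν)` is IRREDUCIBLE** — for every global additive character `ψ` of `𝐀_K/K`, every Gram matrix `T` with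
`y ↦ T y` onto (e.g. `T ∈ GL_ι(𝐀_K)`), and every Haar measure `ν`: a closed subspace invariant under all
`ρ(h) = SchrodingerHaar.rep (adelicForm K ι T) ψ … ν h` (`(ρ((x,y),t)Φ)(u) = ψ(t + ⟨u, T y⟩) Φ(u + x)`, the `L²`
completion of the smooth model `adelicSchrodinger K ι T`) is `⊥` or `⊤`.  This is the hypothesis `_hρi` of the
statement-exact typing `Prop311AsPrinted` for the `L²` model of [GelbartRogawski1991, §3.1 p. 454 L19–21]'s `ρ_ψ`.
[cite: GelbartRogawski1991, §3.1 p. 454 L19–21] [cite: MoeglinVignerasWaldspurger1987, Chap. 2 I.2 Théorème] -/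
theorem adelicSchrodingerL2_irreducible (ψ : AddChar (AdeleRing (𝓞 K) K) Circle) (hψ : IsGlobalAddChar K ψ)
    (T : Matrix ι ι (AdeleRing (𝓞 K) K)) (hT : Function.Surjective fun y : ι → AdeleRing (𝓞 K) K => T *ᵥ y)
    (ν : Measure (ι → AdeleRing (𝓞 K) K)) [ν.IsAddHaarMeasure]
    (L : Submodule ℂ (Lp ℂ 2 ν)) (hLc : IsClosed (L : Set (Lp ℂ 2 ν)))
    (hL : ∀ (h : AdelicHeisenberg K ι T), ∀ f ∈ L,
      SchrodingerHaar.rep (adelicForm K ι T) ψ hψ.continuous (continuous_adelicForm_left K ι T) ν h f ∈ L) :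
    L = ⊥ ∨ L = ⊤ := by
  refine adelicSchrodingerL2_irreducible_one K ι ψ hψ ν L hLc fun h f hf => ?_
  obtain ⟨⟨x, y'⟩, t⟩ := h
  obtain ⟨y, hy⟩ := hT y'
  have e := SchrodingerHaar.rep_eq_rep_of_forall_apply (adelicForm K ι 1) (adelicForm K ι T) ψ ψ hψ.continuous
    hψ.continuous (continuous_adelicForm_left K ι 1) (continuous_adelicForm_left K ι T) ν (x := x) (y₁ := y')
    (t₁ := t) (y₂ := y) (t₂ := t) (fun a => by
      change ψ (adelicForm K ι T a y) = ψ (adelicForm K ι 1 a y')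
      rw [adelicForm_apply, adelicForm_one_apply]
      exact congrArg (fun z => ψ (a ⬝ᵥ z)) hy) rfl f
  rw [← e]
  exact hL _ f hf

end Main

end Literature.NumberTheory.Weil1964

end
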